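import Summits.Parity.GeneralizedHardyLittlewood.Theorems.BeyondDiagonalBeatsQuarter.OffDiagPoissonTwistedLattice
import HarnessLib

/-!
# Route `PrimeLevelFamEdge`, crux K_B (stmt-Parity-20343), line `diagonal_kernel_split`, plan Ω,
# sub-line **d1** (part 4) — Poisson summation APPLIED to one Kloosterman layer: d1 ∘ d2

The joint of d1 (twisted Poisson summation, parts 1–3) and d2 (`OffDiagZeroFrequency`: the complete sums
`Σ_{x₁,x₂ mod c} S(αx₁, βx₂; c) e_c(h₁x₁ + h₂x₂) = c²·#{u ∈ (ℤ/c)ˣ : αu + h₁ = 0, βū + h₂ = 0}`), i.e. GATE G2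
§(a) row a5 «double Poisson `(n₁,n₂)` mod `cq`: `Σ G S(m₁n₁,m₂n₂;cq) = Σ_{h₁h₂ ≡ A (cq)} Ĝ`» for ONE smooth
compactly supported weight `Φ` on the open quadrant (a dyadic box of d4) and ONE modulus `c`:

* **`tsum_nat_prod_mul_kloostermanSum_eq`**: for `α, β ∈ ℤ/c`,
  `Σ_{(n₁,n₂) ∈ ℕ²} Φ(n₁,n₂) S(αn₁, βn₂; c) = Σ_{(h₁,h₂) ∈ ℤ²} Φ̂(h₁/c, h₂/c) · N(h₁,h₂)`,
  `N(h₁,h₂) = #{u ∈ (ℤ/c)ˣ : αu + h₁ = 0, βū + h₂ = 0}` (the factor `c⁻²` of Poisson cancels the `c²` of the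
  complete sum), the right side absolutely convergent (`summable_fourier2_mul_card`);
* the frequencies live on the dual hyperbola `h₁h₂ ≡ αβ (mod c)` (`tsum_nat_prod_mul_kloostermanSum_eq_tsum_hyperbola`,
  from d2's `dualUnits_eq_empty_of_ne`), with `N ≤ 1` when `α` is a unit (d2's `card_dualUnits_le_one`), and the
  zero frequency carries `N(0,0) = 0` as soon as `α ≢ 0` (`card_dualUnits_zero`) — at prime level `q`, `c = qr`,
  `α = l/d₁ ∈ [1, q)`, this is d2's `natCast_ne_zero_of_lt_prime`.

Folklore, PROVED; theorems only; no bound on any off-diagonal term. Helper; closes nothing.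
«The programme SEARCHES and TYPES; no claim about Landau–Siegel zeros, Theorems 1–2 of arXiv:2211.02515
or a repaired Margin232 until a kernel theorem says so.»
-/

noncomputable section

open Real MeasureTheory Filter Complex Finset Set
open scoped FourierTransform Topology ContDiff

namespace Summit.Parity.GeneralizedHardyLittlewood.Theorems.BeyondDiagonalBeatsQuarter.OffDiagPoissonTwisted

open Literature.NumberTheory.Sieve.FriedlanderIwaniecPrimes
open Literature.NumberTheory.LFunctions (kloostermanSum)

variable {c : ℕ} [NeZero c] {Φ : ℝ → ℝ → ℂ}

/-- The dual count `N(h₁,h₂) = #{u ∈ (ℤ/c)ˣ : αu + h₁ = 0, βū + h₂ = 0}` is at most `#(ℤ/c)ˣ ≤ c`. [folklore] -/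
theorem card_dualUnits_le (α β h₁ h₂ : ZMod c) :
    ((univ : Finset (ZMod c)ˣ).filter (fun u : (ZMod c)ˣ =>
        α * (u : ZMod c) + h₁ = 0 ∧ β * ((u⁻¹ : (ZMod c)ˣ) : ZMod c) + h₂ = 0)).card ≤ c := by
  refine (Finset.card_filter_le _ _).trans ?_
  rw [Finset.card_univ]
  calc Fintype.card (ZMod c)ˣ ≤ Fintype.card (ZMod c) :=
        Fintype.card_le_of_injective (fun u : (ZMod c)ˣ => (u : ZMod c)) Units.val_injective
    _ = c := ZMod.card c

/-- **The zero frequency carries no unit** when `α ≢ 0 (mod c)`: `#{u ∈ (ℤ/c)ˣ : αu = 0, βū = 0} = 0`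
(a unit `u` with `αu = 0` forces `α = 0`). [folklore] -/
theorem card_dualUnits_zero {α : ZMod c} (hα : α ≠ 0) (β : ZMod c) :
    ((univ : Finset (ZMod c)ˣ).filter (fun u : (ZMod c)ˣ =>
        α * (u : ZMod c) = 0 ∧ β * ((u⁻¹ : (ZMod c)ˣ) : ZMod c) = 0)).card = 0 := by
  rw [Finset.card_eq_zero]
  exact Finset.filter_false_of_mem fun u _ hu => hα (by
    simpa using congrArg (· * ((u⁻¹ : (ZMod c)ˣ) : ZMod c)) hu.1)

/-- **Poisson summation applied to one Kloosterman layer** (d1 ∘ d2). For `uncurry Φ` smooth of compact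
support with `Φ(t₁,t₂) ≠ 0 ⇒ t₁, t₂ > 0`, `c ≥ 1` and `α, β ∈ ℤ/c`:
`Σ_{(n₁,n₂) ∈ ℕ²} Φ(n₁,n₂) S(αn₁, βn₂; c) = Σ_{(h₁,h₂) ∈ ℤ²} Φ̂(h₁/c,h₂/c) · #{u ∈ (ℤ/c)ˣ : αu + h₁ = 0, βū + h₂ = 0}`
(`Φ̂ = fourier2 Φ`; GATE G2 §(a) row a5). [folklore] -/
theorem tsum_nat_prod_mul_kloostermanSum_eq (hΦ : ContDiff ℝ ∞ (Function.uncurry Φ))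
    (hΦc : HasCompactSupport (Function.uncurry Φ)) (hpos : ∀ t₁ t₂, Φ t₁ t₂ ≠ 0 → 0 < t₁ ∧ 0 < t₂)
    (α β : ZMod c) :
    ∑' n : ℕ × ℕ, Φ n.1 n.2 * kloostermanSum c (α * n.1) (β * n.2) =
      ∑' h : ℤ × ℤ, fourier2 Φ (h.1 / c) (h.2 / c) *
        (((univ : Finset (ZMod c)ˣ).filter (fun u : (ZMod c)ˣ =>
          α * (u : ZMod c) + h.1 = 0 ∧ β * ((u⁻¹ : (ZMod c)ˣ) : ZMod c) + h.2 = 0)).card : ℂ) := by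
  have main := tsum_nat_prod_mul_stdAddChar_eq_of_contDiff hΦ hΦc hpos
    (fun x₁ x₂ : ZMod c => kloostermanSum c (α * x₁) (β * x₂))
  rw [main, ← tsum_mul_left]
  refine tsum_congr fun h => ?_
  rw [OffDiag.sum_sum_kloostermanSum_mul_stdAddChar α β (h.1 : ZMod c) (h.2 : ZMod c)]
  have hc : (c : ℂ) ≠ 0 := by exact_mod_cast NeZero.ne c
  field_simp

/-- The right side of `tsum_nat_prod_mul_kloostermanSum_eq` is absolutely convergent: `h ↦ Φ̂(h/c)·N(h)` is
summable on `ℤ × ℤ` (`N ≤ c`, `Σ|Φ̂(h/c)| < ∞` by `summable_fourier2_lattice_of_contDiff`). [folklore] -/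
theorem summable_fourier2_mul_card (hΦ : ContDiff ℝ ∞ (Function.uncurry Φ))
    (hΦc : HasCompactSupport (Function.uncurry Φ)) (α β : ZMod c) :
    Summable fun h : ℤ × ℤ => fourier2 Φ (h.1 / c) (h.2 / c) *
      (((univ : Finset (ZMod c)ˣ).filter (fun u : (ZMod c)ˣ =>
        α * (u : ZMod c) + h.1 = 0 ∧ β * ((u⁻¹ : (ZMod c)ˣ) : ZMod c) + h.2 = 0)).card : ℂ) := by
  have hcr : (0 : ℝ) < c := by exact_mod_cast Nat.pos_of_ne_zero (NeZero.ne c)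
  refine Summable.of_norm_bounded
    ((summable_fourier2_lattice_of_contDiff hΦ hΦc hcr).norm.mul_right (c : ℝ)) (fun h => ?_)
  rw [norm_mul, Complex.norm_natCast]
  exact mul_le_mul_of_nonneg_left (by exact_mod_cast card_dualUnits_le α β _ _) (norm_nonneg _)

/-- Off the dual hyperbola `h₁h₂ ≡ αβ (mod c)` the summand vanishes (d2's `dualUnits_eq_empty_of_ne`).
[folklore] -/
theorem fourier2_mul_card_eq_zero_of_ne {α β : ZMod c} {h : ℤ × ℤ}
    (hne : (h.1 : ZMod c) * (h.2 : ZMod c) ≠ α * β) :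
    fourier2 Φ (h.1 / c) (h.2 / c) *
      (((univ : Finset (ZMod c)ˣ).filter (fun u : (ZMod c)ˣ =>
        α * (u : ZMod c) + h.1 = 0 ∧ β * ((u⁻¹ : (ZMod c)ˣ) : ZMod c) + h.2 = 0)).card : ℂ) = 0 := by
  rw [OffDiag.dualUnits_eq_empty_of_ne hne, Finset.card_empty, Nat.cast_zero, mul_zero]

/-- **The dual sum lives on the hyperbola `h₁h₂ ≡ αβ (mod c)`**:
`Σ_{(n₁,n₂) ∈ ℕ²} Φ(n₁,n₂) S(αn₁, βn₂; c) = Σ_{(h₁,h₂) ∈ ℤ², h₁h₂ ≡ αβ (c)} Φ̂(h₁/c,h₂/c) · N(h₁,h₂)`.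
[folklore] -/
theorem tsum_nat_prod_mul_kloostermanSum_eq_tsum_hyperbola (hΦ : ContDiff ℝ ∞ (Function.uncurry Φ))
    (hΦc : HasCompactSupport (Function.uncurry Φ)) (hpos : ∀ t₁ t₂, Φ t₁ t₂ ≠ 0 → 0 < t₁ ∧ 0 < t₂)
    (α β : ZMod c) :
    ∑' n : ℕ × ℕ, Φ n.1 n.2 * kloostermanSum c (α * n.1) (β * n.2) =
      ∑' h : {h : ℤ × ℤ | (h.1 : ZMod c) * (h.2 : ZMod c) = α * β},
        fourier2 Φ (h.1.1 / c) (h.1.2 / c) *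
          (((univ : Finset (ZMod c)ˣ).filter (fun u : (ZMod c)ˣ =>
            α * (u : ZMod c) + h.1.1 = 0 ∧ β * ((u⁻¹ : (ZMod c)ˣ) : ZMod c) + h.1.2 = 0)).card : ℂ) := by
  rw [tsum_nat_prod_mul_kloostermanSum_eq hΦ hΦc hpos α β]
  refine (tsum_subtype_eq_of_support_subset
    (f := fun h : ℤ × ℤ => fourier2 Φ (h.1 / c) (h.2 / c) *
      (((univ : Finset (ZMod c)ˣ).filter (fun u : (ZMod c)ˣ =>
        α * (u : ZMod c) + h.1 = 0 ∧ β * ((u⁻¹ : (ZMod c)ˣ) : ZMod c) + h.2 = 0)).card : ℂ))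
    (s := {h : ℤ × ℤ | (h.1 : ZMod c) * (h.2 : ZMod c) = α * β}) fun h hh => ?_).symm
  by_contra hne
  exact Function.mem_support.mp hh (fourier2_mul_card_eq_zero_of_ne hne)


/-! ### One variable: `Σ_n f(n) S(αn, b; c)` (appended; serves the one-variable dispersion steps) -/

section OneVariable

variable {f : ℝ → ℂ}

/-- If `f` lives on `(0,∞)` (`f(t) ≠ 0 ⇒ t > 0`), the sum over `ℤ` is the sum over `ℕ`. [folklore] -/
theorem tsum_nat_mul_eq_tsum_int_mul (hpos : ∀ t, f t ≠ 0 → 0 < t) (G : ℤ → ℂ) :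
    ∑' n : ℕ, f n * G n = ∑' n : ℤ, f n * G n := by
  have key := (Nat.cast_injective (R := ℤ)).tsum_eq (f := fun n : ℤ => f n * G n) ?_
  · simpa using key
  · intro n hn
    have h1 := hpos _ (left_ne_zero_of_mul (Function.mem_support.mp hn))
    have h1' : (0 : ℤ) ≤ n := by exact_mod_cast h1.le
    exact ⟨n.toNat, by simp [Int.toNat_of_nonneg h1']⟩

/-- The twisted period sum of a Kloosterman sum, evaluated (d2's `OffDiag.sum_kloostermanSum_mul_stdAddChar`
in the `Finset.range` / `𝐞` shape of part 1):
`Σ_{0 ≤ x < c} S(αx, b; c) 𝐞(xk/c) = c · Σ_{u ∈ (ℤ/c)ˣ, αu + k = 0} e_c(b ū)`. [folklore] -/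
theorem sum_range_kloostermanSum_mul_fourierChar (α b : ZMod c) (k : ℤ) :
    ∑ x ∈ Finset.range c, kloostermanSum c (α * ((x : ℤ) : ZMod c)) b * (𝐞 ((x : ℝ) * k / c) : ℂ) =
      (c : ℂ) * ∑ u ∈ (univ : Finset (ZMod c)ˣ).filter (fun u : (ZMod c)ˣ => α * (u : ZMod c) + k = 0),
        (ZMod.stdAddChar (b * ((u⁻¹ : (ZMod c)ˣ) : ZMod c)) : ℂ) := by
  rw [← OffDiag.sum_kloostermanSum_mul_stdAddChar α b (k : ZMod c)]
  have h := sum_range_eq_sum_zmod (fun y : ZMod c => kloostermanSum c (α * y) b)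
    (fun x : ℕ => (𝐞 ((x : ℝ) * k / c) : ℂ))
  simp only [Int.cast_natCast]
  rw [h]
  exact Finset.sum_congr rfl fun y _ => by rw [fourierChar_val_mul_div]

/-- **Poisson summation applied to a Kloosterman sum in one variable** (d1 ∘ d2). For `f : ℝ → ℂ` smooth of
compact support, `c ≥ 1` and `α, b ∈ ℤ/c`:
`Σ_{n ∈ ℤ} f(n) S(αn, b; c) = Σ_{k ∈ ℤ} 𝓕f(k/c) · Σ_{u ∈ (ℤ/c)ˣ, αu + k = 0} e_c(b ū)`
(the factor `c⁻¹` of Poisson cancels the `c` of the complete sum). [folklore] -/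
theorem tsum_int_mul_kloostermanSum_eq (hf : ContDiff ℝ ∞ f) (hfc : HasCompactSupport f) (α b : ZMod c) :
    ∑' n : ℤ, f n * kloostermanSum c (α * n) b =
      ∑' k : ℤ, 𝓕 f ((k : ℝ) / c) *
        ∑ u ∈ (univ : Finset (ZMod c)ˣ).filter (fun u : (ZMod c)ˣ => α * (u : ZMod c) + k = 0),
          (ZMod.stdAddChar (b * ((u⁻¹ : (ZMod c)ˣ) : ZMod c)) : ℂ) := by
  have hc0 : 0 < c := Nat.pos_of_ne_zero (NeZero.ne c)
  have hper : ∀ m n : ℤ, kloostermanSum c (α * ((m + c * n : ℤ) : ZMod c)) b =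
      kloostermanSum c (α * (m : ZMod c)) b := by
    intro m n
    congr 2
    push_cast
    simp
  rw [tsum_mul_periodic_eq (g := fun n : ℤ => kloostermanSum c (α * (n : ZMod c)) b) hf hfc hc0 hper,
    ← tsum_mul_left]
  refine tsum_congr fun k => ?_
  rw [sum_range_kloostermanSum_mul_fourierChar]
  have hc : (c : ℂ) ≠ 0 := by exact_mod_cast NeZero.ne c
  field_simp

/-- The same with the left side over `ℕ`, for `f` living on `(0,∞)`:
`Σ_{n ∈ ℕ} f(n) S(αn, b; c) = Σ_{k ∈ ℤ} 𝓕f(k/c) · Σ_{u ∈ (ℤ/c)ˣ, αu + k = 0} e_c(b ū)`. [folklore] -/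
theorem tsum_nat_mul_kloostermanSum_eq (hf : ContDiff ℝ ∞ f) (hfc : HasCompactSupport f)
    (hpos : ∀ t, f t ≠ 0 → 0 < t) (α b : ZMod c) :
    ∑' n : ℕ, f n * kloostermanSum c (α * n) b =
      ∑' k : ℤ, 𝓕 f ((k : ℝ) / c) *
        ∑ u ∈ (univ : Finset (ZMod c)ˣ).filter (fun u : (ZMod c)ˣ => α * (u : ZMod c) + k = 0),
          (ZMod.stdAddChar (b * ((u⁻¹ : (ZMod c)ˣ) : ZMod c)) : ℂ) := by
  rw [← tsum_int_mul_kloostermanSum_eq hf hfc α b,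
    ← tsum_nat_mul_eq_tsum_int_mul hpos (fun n : ℤ => kloostermanSum c (α * (n : ZMod c)) b)]
  exact tsum_congr fun n => by simp

/-- The dual unit sum is bounded by `c`: `|Σ_{u ∈ (ℤ/c)ˣ, αu + k = 0} e_c(b ū)| ≤ c`. [folklore] -/
theorem norm_unitSum_le (α b : ZMod c) (k : ℤ) :
    ‖∑ u ∈ (univ : Finset (ZMod c)ˣ).filter (fun u : (ZMod c)ˣ => α * (u : ZMod c) + k = 0),
        (ZMod.stdAddChar (b * ((u⁻¹ : (ZMod c)ˣ) : ZMod c)) : ℂ)‖ ≤ c := by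
  refine (norm_sum_le _ _).trans ?_
  have h1 : ∀ u ∈ (univ : Finset (ZMod c)ˣ).filter (fun u : (ZMod c)ˣ => α * (u : ZMod c) + k = 0),
      ‖(ZMod.stdAddChar (b * ((u⁻¹ : (ZMod c)ˣ) : ZMod c)) : ℂ)‖ = 1 := fun u _ => AddChar.norm_apply _ _
  rw [Finset.sum_congr rfl h1, Finset.sum_const, nsmul_eq_mul, mul_one]
  have h2 := (Finset.card_filter_le (univ : Finset (ZMod c)ˣ)
    (fun u : (ZMod c)ˣ => α * (u : ZMod c) + k = 0)).trans
    ((Finset.card_univ (α := (ZMod c)ˣ)).le.trans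
      ((Fintype.card_le_of_injective (fun u : (ZMod c)ˣ => (u : ZMod c)) Units.val_injective).trans
        (ZMod.card c).le))
  exact_mod_cast h2

/-- The right side of `tsum_int_mul_kloostermanSum_eq` is absolutely convergent. [folklore] -/
theorem summable_fourier_mul_unitSum (hf : ContDiff ℝ ∞ f) (hfc : HasCompactSupport f) (α b : ZMod c) :
    Summable fun k : ℤ => 𝓕 f ((k : ℝ) / c) *
      ∑ u ∈ (univ : Finset (ZMod c)ˣ).filter (fun u : (ZMod c)ˣ => α * (u : ZMod c) + k = 0),
        (ZMod.stdAddChar (b * ((u⁻¹ : (ZMod c)ˣ) : ZMod c)) : ℂ) := by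
  have hcr : (0 : ℝ) < c := by exact_mod_cast Nat.pos_of_ne_zero (NeZero.ne c)
  refine Summable.of_norm_bounded ((summable_fourier_div hf hfc hcr).norm.mul_right (c : ℝ)) fun k => ?_
  rw [norm_mul]
  exact mul_le_mul_of_nonneg_left (norm_unitSum_le α b k) (norm_nonneg _)

end OneVariable

end Summit.Parity.GeneralizedHardyLittlewood.Theorems.BeyondDiagonalBeatsQuarter.OffDiagPoissonTwisted
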